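import Literature.NumberTheory.LFunctions.WeilArchDensityPanels
import Literature.NumberTheory.LFunctions.WeilArchDensityAsymptotics
import Literature.Analysis.ValidatedNumerics.TaylorModelExp
import Mathlib.Analysis.SpecialFunctions.Trigonometric.ArctanDeriv
import Mathlib.MeasureTheory.Integral.IntegralEqImproper
import HarnessLib

/-!
# The archimedean density of Weil's explicit formula, IV: the tail `Ψ(L) = ∫_L^∞ ρ` in closed form

Topic `Literature/NumberTheory/LFunctions` (sequel of `WeilArchDensityMoments.lean`, `WeilArchDensityPanels.lean`).
The archimedean density `ρ(t) = e^{t/2}/(2 sinh t) = e^{-t/2}/(1 − e^{-2t})` of the windowed Weil form has the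
ELEMENTARY tail

  `Ψ(L) := ∫_{(L,∞)} ρ(t) dt = artanh(e^{-L/2}) + arctan(e^{-L/2})
        = ½ log((1 + e^{-L/2})/(1 − e^{-L/2})) + arctan(e^{-L/2})`,   `L > 0`

(substitute `u = e^{-t/2}`: `ρ dt = −2 du/(1 − u⁴) = −(1/(1−u²) + 1/(1+u²)) du`).  This is the function through
which the WINDOW IMAGE `F = L v` of a windowed trial vector `v = 𝟙_{[-c,c]} g` carries its edge singularity:
`F(y) ∋ g(y)·(Ψ(c − y) + Ψ(c + y))` with `Ψ(L) = −½ log L + (log 2 + π/4) + O(L)` as `L → 0⁺` — the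
logarithm isolated EXACTLY by `1 − e^{-L/2} = (L/2)·φ(L/2)`, `φ(u) = (1 − e^{-u})/u` (`PolyMP.phiExp`, entire,
`φ(0) = 1`):

  `Ψ(L) = −½ log L + [½ log 2 + ½ log(1 + e^{-L/2}) − ½ log φ(L/2) + arctan(e^{-L/2})]`   (`weilArchTail_eq_log`),

the bracket (`weilArchTailReg`, `weilArchTailReg_eq`) being analytic on a neighbourhood of `[0, ∞)`.  Contents:
`weilArchTail` (the tail as a set integral), `hasDerivAt_weilArchTailClosed` (`Φ' = −ρ`),
`tendsto_weilArchTailClosed_atTop` (`Φ → 0`), `weilArchTail_eq` (the closed form), `weilArchTail_sub_eq_integral`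
(`Ψ(a) − Ψ(b) = ∫_a^b ρ`), `weilArchTail_pos`, `weilArchTail_eq_log`, `weilArchTailReg_eq`.  All proved; no named facts.
Used by the R-layer (window-image enclosures) of the deflated Temple L-sides of GroundBarta rung 4 / the parity ladder.

## References
* E. Bombieri, *Remarks on Weil's quadratic functional in the theory of prime numbers I*, Rend. Mat. Acc. Lincei (9) 11
  (2000) 183–233, Thm 2 (the density `x dx/(x² − 1)`, `x = e^t`). [Bombieri2000Weil]
* [folklore] (`∫ du/(1−u⁴) = ½(artanh u + arctan u)`).
-/

noncomputable section

open Real Set MeasureTheory Filter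
open scoped Topology

namespace Literature.NumberTheory.LFunctions

open Literature.Analysis.ValidatedNumerics.PolyMP (phiExp)

/-! ## The tail and its closed form -/

/-- The tail of the archimedean density: `Ψ(L) = ∫_{(L,∞)} ρ(t) dt` (finite for `L > 0`, `~ ½ log(1/L)` at `0⁺`).
[cite: Bombieri2000Weil, Thm 2 (p. 193)] -/
def weilArchTail (L : ℝ) : ℝ := ∫ t in Ioi L, weilArchDensity t

/-- The closed form `Φ(L) = ½ log((1 + e^{-L/2})/(1 − e^{-L/2})) + arctan(e^{-L/2})` (`= artanh(e^{-L/2}) + arctan(e^{-L/2})`).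
[folklore] -/
def weilArchTailClosed (L : ℝ) : ℝ :=
  (1 / 2) * Real.log ((1 + Real.exp (-(L / 2))) / (1 - Real.exp (-(L / 2)))) + Real.arctan (Real.exp (-(L / 2)))

/-- `0 < e^{-L/2} < 1` for `L > 0`. [folklore] -/
theorem exp_neg_half_mem_Ioo {L : ℝ} (hL : 0 < L) : Real.exp (-(L / 2)) ∈ Ioo (0 : ℝ) 1 :=
  ⟨Real.exp_pos _, Real.exp_lt_one_iff.2 (by linarith)⟩

/-- `ρ(t) = q/(1 − q⁴)` with `q = e^{-t/2}`, `t ≠ 0`. [cite: Bombieri2000Weil, Thm 2 (p. 193)] -/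
theorem weilArchDensity_eq_of_exp_neg_half {t : ℝ} (ht : t ≠ 0) :
    weilArchDensity t = Real.exp (-(t / 2)) / (1 - Real.exp (-(t / 2)) ^ 4) := by
  rw [weilArchDensity_eq_exp_div ht, ← Real.exp_nat_mul]
  congr 2; push_cast; ring

/-- **`Φ' = −ρ` on `(0, ∞)`.** [folklore] -/
theorem hasDerivAt_weilArchTailClosed {t : ℝ} (ht : 0 < t) :
    HasDerivAt weilArchTailClosed (-weilArchDensity t) t := by
  obtain ⟨hq0, hq1⟩ := exp_neg_half_mem_Ioo ht
  -- the inner function `q(t) = e^{-t/2}`, `q' = -q/2`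
  have hqd : HasDerivAt (fun s : ℝ ↦ Real.exp (-(s / 2))) (Real.exp (-(t / 2)) * (-(1 / 2))) t := by
    have h1 : HasDerivAt (fun s : ℝ ↦ -(s / 2)) (-(1 / 2 : ℝ)) t := by
      have h := (hasDerivAt_neg t).div_const (2 : ℝ)
      simp only [neg_div] at h
      exact h
    exact h1.exp
  have hlog1 : HasDerivAt (fun s : ℝ ↦ Real.log (1 + Real.exp (-(s / 2))))
      ((0 + Real.exp (-(t / 2)) * (-(1 / 2))) / (1 + Real.exp (-(t / 2)))) t :=
    ((hasDerivAt_const t (1 : ℝ)).add hqd).log (by simp only [Pi.add_apply]; positivity)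
  have hlog2 : HasDerivAt (fun s : ℝ ↦ Real.log (1 - Real.exp (-(s / 2))))
      ((0 - Real.exp (-(t / 2)) * (-(1 / 2))) / (1 - Real.exp (-(t / 2)))) t :=
    ((hasDerivAt_const t (1 : ℝ)).sub hqd).log (by simp only [Pi.sub_apply]; linarith)
  have hatan : HasDerivAt (fun s : ℝ ↦ Real.arctan (Real.exp (-(s / 2))))
      ((1 / (1 + Real.exp (-(t / 2)) ^ 2)) * (Real.exp (-(t / 2)) * (-(1 / 2)))) t :=
    hqd.arctan
  have hsum := ((hlog1.sub hlog2).const_mul (1 / 2 : ℝ)).add hatan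
  refine (hsum.congr_of_eventuallyEq ?_).congr_deriv ?_
  · -- `Φ` in the form `½ (log(1+q) − log(1−q)) + arctan q` near `t`
    filter_upwards [Ioi_mem_nhds ht] with s hs
    obtain ⟨hs0, hs1⟩ := exp_neg_half_mem_Ioo (mem_Ioi.1 hs)
    unfold weilArchTailClosed
    simp only [Pi.add_apply, Pi.sub_apply]
    rw [Real.log_div (by linarith) (by linarith)]
  · rw [weilArchDensity_eq_of_exp_neg_half ht.ne']
    set q : ℝ := Real.exp (-(t / 2)) with hq
    have h1q : (1 : ℝ) - q ≠ 0 := by linarith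
    have h1q' : (1 : ℝ) + q ≠ 0 := by linarith
    have h1q2 : (1 : ℝ) + q ^ 2 ≠ 0 := by positivity
    have h1q4 : (1 : ℝ) - q ^ 4 ≠ 0 := by
      have : q ^ 4 < 1 := pow_lt_one₀ hq0.le hq1 (by norm_num)
      linarith
    field_simp
    ring

/-- **`Φ(t) → 0` as `t → ∞`.** [folklore] -/
theorem tendsto_weilArchTailClosed_atTop : Tendsto weilArchTailClosed atTop (𝓝 0) := by
  have hq : Tendsto (fun t : ℝ ↦ Real.exp (-(t / 2))) atTop (𝓝 0) := by
    refine Real.tendsto_exp_comp_nhds_zero.2 ?_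
    have : Tendsto (fun t : ℝ ↦ t / 2) atTop atTop := tendsto_id.atTop_div_const (by norm_num)
    exact tendsto_neg_atTop_atBot.comp this
  have hcont : ContinuousAt (fun u : ℝ ↦ (1 / 2) * Real.log ((1 + u) / (1 - u)) + Real.arctan u) 0 := by
    have h1 : ContinuousAt (fun u : ℝ ↦ (1 + u) / (1 - u)) 0 :=
      (continuousAt_const.add continuousAt_id).div (continuousAt_const.sub continuousAt_id) (by norm_num)
    have h2 : ContinuousAt (fun u : ℝ ↦ Real.log ((1 + u) / (1 - u))) 0 :=
      ContinuousAt.comp (g := Real.log) (Real.continuousAt_log (by norm_num)) h1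
    exact (continuousAt_const.mul h2).add Real.continuous_arctan.continuousAt
  have h := hcont.tendsto.comp hq
  simp only [add_zero, sub_zero, div_one, Real.log_one, mul_zero, Real.arctan_zero,
    Function.comp_def] at h
  exact h

/-- `Φ` is continuous on `(0, ∞)`. [folklore] -/
theorem continuousOn_weilArchTailClosed : ContinuousOn weilArchTailClosed (Ioi 0) :=
  fun _ ht ↦ (hasDerivAt_weilArchTailClosed (mem_Ioi.1 ht)).continuousAt.continuousWithinAt

/-- **The tail in closed form**: for `L > 0`,
`∫_{(L,∞)} ρ = ½ log((1 + e^{-L/2})/(1 − e^{-L/2})) + arctan(e^{-L/2})`.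
[cite: Bombieri2000Weil, Thm 2 (p. 193) (the density); folklore (the primitive artanh + arctan of e^{-t/2})] -/
theorem weilArchTail_eq {L : ℝ} (hL : 0 < L) : weilArchTail L = weilArchTailClosed L := by
  have hI : IntegrableOn weilArchDensity (Ioi L) := (weilArchDensity_tail_eq_sum_add hL 0).1
  have hcont : ContinuousWithinAt (fun t ↦ -weilArchTailClosed t) (Ici L) L :=
    (hasDerivAt_weilArchTailClosed hL).continuousAt.neg.continuousWithinAt
  have hder : ∀ t ∈ Ioi L, HasDerivAt (fun t ↦ -weilArchTailClosed t) (weilArchDensity t) t := fun t ht ↦ by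
    have h := (hasDerivAt_weilArchTailClosed (hL.trans (mem_Ioi.1 ht))).neg
    rw [neg_neg] at h
    exact h
  have hlim : Tendsto (fun t ↦ -weilArchTailClosed t) atTop (𝓝 (-0)) := tendsto_weilArchTailClosed_atTop.neg
  have h := integral_Ioi_of_hasDerivAt_of_tendsto hcont hder hI hlim
  rw [weilArchTail, h]
  ring

/-- **Differences of the tail are interval integrals**: `Ψ(a) − Ψ(b) = ∫_a^b ρ` for `0 < a ≤ b`. [folklore] -/
theorem weilArchTail_sub_eq_integral {a b : ℝ} (ha : 0 < a) (hab : a ≤ b) :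
    weilArchTail a - weilArchTail b = ∫ t in a..b, weilArchDensity t := by
  rw [weilArchTail_eq ha, weilArchTail_eq (ha.trans_le hab)]
  have hcont : ContinuousOn weilArchDensity (Icc a b) := by
    refine ContinuousOn.div (by fun_prop) (by fun_prop) fun t ht ↦ ?_
    exact mul_ne_zero two_ne_zero (Real.sinh_pos_iff.2 (ha.trans_le ht.1)).ne'
  have hderiv : ∀ t ∈ uIcc a b, HasDerivAt (fun t ↦ -weilArchTailClosed t) (weilArchDensity t) t := by
    intro t ht
    rw [uIcc_of_le hab] at ht
    have h := (hasDerivAt_weilArchTailClosed (ha.trans_le ht.1)).neg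
    rw [neg_neg] at h
    exact h
  have h := intervalIntegral.integral_eq_sub_of_hasDerivAt hderiv
    ((hcont.mono (by rw [uIcc_of_le hab])).intervalIntegrable)
  rw [h]
  ring

/-- `Ψ(a) − Ψ(b) = ∫_{(a,b]} ρ` for `0 < a ≤ b` (set-integral form). [folklore] -/
theorem weilArchTail_sub_eq_setIntegral {a b : ℝ} (ha : 0 < a) (hab : a ≤ b) :
    weilArchTail a - weilArchTail b = ∫ t in Ioc a b, weilArchDensity t := by
  rw [weilArchTail_sub_eq_integral ha hab, intervalIntegral.integral_of_le hab]

/-- The tail is positive. [folklore] -/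
theorem weilArchTail_pos {L : ℝ} (hL : 0 < L) : 0 < weilArchTail L := by
  have hI : IntegrableOn weilArchDensity (Ioi L) := (weilArchDensity_tail_eq_sum_add hL 0).1
  rw [weilArchTail]
  have hpos : ∀ t ∈ Ioi L, 0 < weilArchDensity t := fun t ht ↦ weilArchDensity_pos (hL.trans ht)
  exact setIntegral_pos_iff_support_of_nonneg_ae
    ((ae_restrict_iff' measurableSet_Ioi).2 (Eventually.of_forall fun t ht ↦ (hpos t ht).le)) hI |>.2
    (by
      have hsub : Ioi L ⊆ Function.support weilArchDensity ∩ Ioi L := fun t ht ↦ ⟨(hpos t ht).ne', ht⟩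
      exact lt_of_lt_of_le (by simp [Real.volume_Ioi]) (measure_mono hsub))

/-- The tail is antitone on `(0, ∞)`. [folklore] -/
theorem weilArchTail_antitoneOn : AntitoneOn weilArchTail (Ioi 0) := by
  intro a ha b _ hab
  have h := weilArchTail_sub_eq_integral (mem_Ioi.1 ha) hab
  have h0 : 0 ≤ ∫ t in a..b, weilArchDensity t :=
    intervalIntegral.integral_nonneg hab fun t ht ↦ (weilArchDensity_pos ((mem_Ioi.1 ha).trans_le ht.1)).le
  linarith

/-! ## The logarithmic singularity at `0⁺`, isolated exactly -/

/-- `1 − e^{-L/2} = (L/2) · φ(L/2)` with `φ(u) = (1 − e^{-u})/u` (`PolyMP.phiExp`), `L ≠ 0`. [folklore] -/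
theorem one_sub_exp_neg_half_eq_mul_phiExp {L : ℝ} (hL : L ≠ 0) :
    1 - Real.exp (-(L / 2)) = L / 2 * phiExp (L / 2) := by
  have h2 : L / 2 ≠ 0 := div_ne_zero hL two_ne_zero
  rw [phiExp, if_neg h2, mul_div_cancel₀ _ h2]

/-- `φ(u) > 0` for `u > 0`. [folklore] -/
theorem phiExp_pos {u : ℝ} (hu : 0 < u) : 0 < phiExp u := by
  rw [phiExp, if_neg hu.ne']
  exact div_pos (by linarith [Real.exp_lt_one_iff.2 (neg_lt_zero.2 hu)]) hu

/-- The regular part of the tail: `Ψ̃(L) = Ψ(L) + ½ log L`. [folklore] -/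
def weilArchTailReg (L : ℝ) : ℝ := weilArchTail L + (1 / 2) * Real.log L

/-- **The tail with its logarithm isolated**: for `L > 0`,
`Ψ(L) = −½ log L + (½ log 2 + ½ log(1 + e^{-L/2}) − ½ log φ(L/2) + arctan(e^{-L/2}))`.
[cite: Bombieri2000Weil, Thm 2 (p. 193) (the density); folklore] -/
theorem weilArchTail_eq_log {L : ℝ} (hL : 0 < L) :
    weilArchTail L = -(1 / 2) * Real.log L +
      (Real.log 2 / 2 + (1 / 2) * Real.log (1 + Real.exp (-(L / 2))) -
        (1 / 2) * Real.log (phiExp (L / 2)) + Real.arctan (Real.exp (-(L / 2)))) := by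
  obtain ⟨hq0, hq1⟩ := exp_neg_half_mem_Ioo hL
  rw [weilArchTail_eq hL, weilArchTailClosed, Real.log_div (by linarith) (by linarith),
    one_sub_exp_neg_half_eq_mul_phiExp hL.ne',
    Real.log_mul (div_ne_zero hL.ne' two_ne_zero) (phiExp_pos (by linarith)).ne',
    Real.log_div hL.ne' two_ne_zero]
  ring

/-- **The regular part in closed form**: for `L > 0`,
`Ψ̃(L) = ½ log 2 + ½ log(1 + e^{-L/2}) − ½ log φ(L/2) + arctan(e^{-L/2})` — a function analytic on a neighbourhood
of `[0, ∞)` with `Ψ̃(0⁺) = log 2 + π/4`. [folklore] -/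
theorem weilArchTailReg_eq {L : ℝ} (hL : 0 < L) :
    weilArchTailReg L = Real.log 2 / 2 + (1 / 2) * Real.log (1 + Real.exp (-(L / 2))) -
      (1 / 2) * Real.log (phiExp (L / 2)) + Real.arctan (Real.exp (-(L / 2))) := by
  rw [weilArchTailReg, weilArchTail_eq_log hL]
  ring

/-- The value of the regular part's closed form at `L = 0` is `log 2 + π/4`. [folklore] -/
theorem weilArchTailReg_closedForm_zero :
    Real.log 2 / 2 + (1 / 2) * Real.log (1 + Real.exp (-((0 : ℝ) / 2))) -
      (1 / 2) * Real.log (phiExp ((0 : ℝ) / 2)) + Real.arctan (Real.exp (-((0 : ℝ) / 2))) =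
      Real.log 2 + π / 4 := by
  simp [phiExp]
  ring

end Literature.NumberTheory.LFunctions

end
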